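import Literature.NumberTheory.Automorphic.PairLFunctionMeromorphicContinuationNeConjLocalReduction
import Literature.NumberTheory.Automorphic.PairLFunctionNeConjGlobalRankinSelbergTwisted
import Literature.NumberTheory.Automorphic.SmoothedFormCentralCharacter

/-!
# The pairs without a common central action, from the local theory — orthogonal form

Summit `Langlands`, sub-problem `Langlands`, helper file under `Theorems/` supporting the crux
`PairLBoundaryJS` (stmt-Langlands-13622, Arthur–Clozel (1989), Ch. 3, (2.2)), line `Sketch`.

`partialPairL_entire_of_not_commonCentral_of_local_isOrtho` (**main**) is the orthogonal form of the
tree theorem `Literature.NumberTheory.Automorphic.exists_entire_eq_partialPairL_of_not_commonCentral_of_local`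
(`PairLFunctionMeromorphicContinuationNeConjLocalReductionTwisted`): the binder
`multiplicity_one_gl n K μ'` of that theorem (in the local hypothesis `hloc` and in the conclusion) is
replaced by the orthogonality `π ⟂ σ̄` of the two cuspidal constituents inside `L²_cusp(GL_n)`, which is
only threaded into `hloc`. It discharges the input `htw` of
`partialPairL_entire_of_isOrtho_conj_of_local` (`PairLFunctionNeConjOrthogonalLocalReduction`) from the
local Rankin–Selberg theory for the orthogonal pairs `π ≠ σ̄` alone.

Proof (Cogdell (2004), §2.3, p. 211; verbatim the tree proof): for a pair `π ≠ σ̄` on which the centre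
does not act through common scalars of modulus one, the central characters `ω = ω_π`, `ω' = ω_{σ̄}`
(`CuspidalAutomorphicRepGL.exists_centralCharacter_smoothedForm`) differ, so `η = ω ω'⁻¹ ≠ 1` is
unitary and trivial on `A_G`; the twisted global Rankin–Selberg theorem
(`exists_entire_eq_partialPairL_mul_setIntegral_pair_twisted`; the mirabolic Eisenstein series twisted
by `η ≠ 1` has no poles) gives entire `F_i = C A_i L^{S₀}` on the strip `1 < re s < 2` for the data
of `hloc`, and `G = C⁻¹ B ∑ c_i F_i` is entire and equals `L^{S₀}` on the strip, hence on `re s > 1`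
(`eq_mul_partialPairL_of_eqOn_strip`).

## References

* J. W. Cogdell, *Analytic theory of L-functions for GL_n*, in *An Introduction to the Langlands
  Program* (2004), §2.3 (p. 211), §4.2 [CogdellAnalyticTheory2004].
* C. Mœglin, J.-L. Waldspurger, *Le spectre résiduel de GL(n)*, Ann. Sci. ÉNS 22 (1989), Appendice,
  Corollaire (i)(b), p. 667 [MoeglinWaldspurger1989].
-/

noncomputable section

-- `Summit.Langlands.Langlands.…` (summit = sub-problem name, D-0017 layout) trips `dupNamespace`
set_option linter.dupNamespace false

open scoped MatrixGroups Topology Pointwise ENNReal NNReal ComplexConjugate InnerProductSpace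
open NumberField IsDedekindDomain MeasureTheory Measure Matrix Set Filter
open Literature.NumberTheory.Automorphic AdelicGroupData
open Literature.NumberTheory.GaloisRepresentations (ideleGroup)

-- the automorphic quotient carries the tree's Borel σ-algebra, not Mathlib's quotient σ-algebra
attribute [-instance] Quotient.instMeasurableSpace QuotientGroup.measurableSpace

-- the house local instances, exactly as in `RankinSelbergUnfoldingIdentity`
attribute [local instance] adelicBorel borelSpace_adelic locallyCompactSpace_adelic secondCountableTopology_gl_adelic
  glAdeleBorel borelSpace_glAdele borelSpace_ideleGroup secondCountableTopology_ideleGroup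

namespace Summit.Langlands.Langlands.Theorems

/-- **The orthogonal pairs without a common central action, from the local theory.** Fix Haar
measures `ν_I`, `νA`, `νK`, `ν₀`. Assume `hloc` — the local Rankin–Selberg theory for every pair of
cuspidal constituents `π ≠ σ̄`, `π ⟂ σ̄` of `L²_cusp(GL_n(K)\GL_n(𝔸_K))`: for every finite `S₀`
carrying Satake families `α`, `β` there are finitely many data of the method (`f_i ∈ π`, `f'_i ∈ σ̄`,
levels `𝔫_i`, test functions `η_i` of level `K(𝔫_i)`, finite `S'_i ⊇ S₀` off which `v ∤ 𝔫_i 𝔡_K`,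
enumerations of `α`, `β̄` off `S'_i`, standard Schwartz–Bruhat data `Φ_{i,∞}`) and coefficients `c_i`
such that `∑_i c_i (∏_{v ∈ S'_i ∖ S₀} det(1 - A_v ⊗ B_v q_v^{-s})) Ψ_{S'_i}(s)` has on `1 < re s < 2`
a reciprocal extending to an ENTIRE `B`. Then for `0 < n`, cuspidal `π ≠ σ̄` with `π ⟂ σ̄` on which
the centre does NOT act through common scalars of modulus one, and Satake families `α`, `β` off a
finite `S₀`, the partial `L`-function `partialPairL S₀ α β` extends from `re s > 1` to an entire
function. The orthogonal form of
`Literature.NumberTheory.Automorphic.exists_entire_eq_partialPairL_of_not_commonCentral_of_local`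
(multiplicity one replaced by `π ⟂ σ̄`, which is only passed on to `hloc`); proof verbatim: the
central characters `ω_π ≠ ω_{σ̄}` (`exists_centralCharacter_smoothedForm`), `η = ω_π ω_{σ̄}⁻¹ ≠ 1`
unitary and trivial on `A_G`, the twisted global theorem
`exists_entire_eq_partialPairL_mul_setIntegral_pair_twisted` gives entire `F_i = C A_i L^{S₀}` on the
strip, and `G = C⁻¹ B ∑ c_i F_i` is entire and equals `L^{S₀}` on the strip, hence on `re s > 1`
(`eq_mul_partialPairL_of_eqOn_strip`). Cogdell (2004), §2.3 p. 211, §4.2; Mœglin–Waldspurger (1989),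
Appendice, Cor. (i)(b). -/
theorem partialPairL_entire_of_not_commonCentral_of_local_isOrtho :
    ∀ {n : ℕ} {K : Type} [Field K] [NumberField K]
      {μ' : Measure (AdelicGroupData.gl n K).automorphicQuotient}
      [(AdelicGroupData.gl n K).IsAutomorphicMeasure μ']
      [MeasurableSpace (AdeleRing (𝓞 K) K)] [BorelSpace (AdeleRing (𝓞 K) K)]
      (νI : Measure (ideleGroup K)) [νI.IsHaarMeasure]
      (νA : Measure (Fin n → ideleGroup K)) [IsHaarMeasure νA]
      (νK : Measure ↥(maximalCompactAdelic n K)) [IsHaarMeasure νK]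
      (ν₀ : Measure ↥(adelicUnipotent n K)) [IsHaarMeasure ν₀]
      (_hloc :
        ∀ (_hn : 0 < n)
        (P P' : CuspidalAutomorphicRepGL n K μ') (_hne : P ≠ P'.conj)
        (_hor : P.1.toSubmodule ⟂ P'.conj.1.toSubmodule)
        {S₀ : Set (HeightOneSpectrum (𝓞 K))} (_hS₀ : S₀.Finite) {α β : SatakeFamily K}
        (_hα : IsSatakeFamilyOf P S₀ α) (_hβ : IsSatakeFamilyOf P' S₀ β),
        ∃ (m : ℕ) (c : Fin m → ℂ) (f : Fin m → P.1.toSubmodule) (f' : Fin m → P'.conj.1.toSubmodule)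
        (𝔫₀ : Fin m → Ideal (𝓞 K)) (_h𝔫₀ : ∀ i, 𝔫₀ i ≠ 0)
        (η : Fin m → (AdelicGroupData.gl n K).Adelic → ℝ) (_hη : ∀ i, IsTestFunctionGL n K (η i))
        (_hηK : ∀ i, ∀ k : (AdelicGroupData.gl n K).Adelic, k ∈ principalCongruenceLevel n K (𝔫₀ i) →
        ∀ g : (AdelicGroupData.gl n K).Adelic, η i (k * g) = η i g)
        (S' : Fin m → Set (HeightOneSpectrum (𝓞 K))) (hS'f : ∀ i, (S' i \ S₀).Finite) (_hS₀S' : ∀ i, S₀ ⊆ S' i)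
        (_hS' : ∀ i, ∀ v ∉ S' i, ¬ v.asIdeal ∣ 𝔫₀ i ∧ ¬ v.asIdeal ∣ differentIdeal ℤ (𝓞 K))
        (x y : Fin m → HeightOneSpectrum (𝓞 K) → Fin n → ℂ)
        (_hx : ∀ i, ∀ v ∉ S' i, (Finset.univ : Finset (Fin n)).val.map (x i v) = α v)
        (_hy : ∀ i, ∀ v ∉ S' i, (Finset.univ : Finset (Fin n)).val.map (y i v) = (β v).map conj)
        (Φinf : Fin m → (Fin n → InfiniteAdeleRing K) → ℝ) (_hΦc : ∀ i, Continuous (Φinf i))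
        (_hΦ0 : ∀ i, ∀ z, 0 ≤ Φinf i z)
        (_hΦS : ∀ i, (fun v => ((standardTestFun n K (Φinf i) v : ℝ) : ℂ)) ∈ piSchwartzBruhat K (Fin n))
        (B : ℂ → ℂ), Differentiable ℂ B ∧
        ∀ s : ℂ, 1 < s.re → s.re < 2 →
        B s * (∑ i, c i * ((∏ v ∈ (hS'f i).toFinset,
        (satakePairPolynomial (α v) (β v)).eval ((v.residueCard : ℂ) ^ (-s))) *
        ∫ p in unitBox {v | v ∉ S' i} ×ˢ Set.univ, torusPairIntegrandC n K
        (whittakerCoeff ν₀ (unipotentTateDomain n K) (adeleAddChar K)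
        (invQuot (AdelicGroupData.gl n K) (smoothedForm (η i) ((f i : P.1.toSubmodule) : (AdelicGroupData.gl n K).L2 μ'))))
        (star (whittakerCoeff ν₀ (unipotentTateDomain n K) (adeleAddChar K)
        (invQuot (AdelicGroupData.gl n K) (smoothedForm (η i) ((f' i : P'.conj.1.toSubmodule) : (AdelicGroupData.gl n K).L2 μ')))))
        (standardTestFun n K (Φinf i)) s p ∂(νA.prod νK))) = 1),
      ∀ (_hn : 0 < n)
      (P P' : CuspidalAutomorphicRepGL n K μ') (_hne : P ≠ P'.conj)
      (_hor : P.1.toSubmodule ⟂ P'.conj.1.toSubmodule)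
      (_hω : ¬ (∀ z : ideleGroup K, ∃ c : ℂ, ‖c‖ = 1 ∧
      (∀ f : P.1.toSubmodule,
      (AdelicGroupData.gl n K).rightRegular μ' (Matrix.GeneralLinearGroup.scalar (Fin n) z)
      (f : (AdelicGroupData.gl n K).L2 μ') = c • (f : (AdelicGroupData.gl n K).L2 μ')) ∧
      (∀ f' : P'.conj.1.toSubmodule,
      (AdelicGroupData.gl n K).rightRegular μ' (Matrix.GeneralLinearGroup.scalar (Fin n) z)
      (f' : (AdelicGroupData.gl n K).L2 μ') = c • (f' : (AdelicGroupData.gl n K).L2 μ'))))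
      {S₀ : Set (HeightOneSpectrum (𝓞 K))} (_hS₀ : S₀.Finite) {α β : SatakeFamily K}
      (_hα : IsSatakeFamilyOf P S₀ α) (_hβ : IsSatakeFamilyOf P' S₀ β),
      ∃ g : ℂ → ℂ, Differentiable ℂ g ∧ ∀ s : ℂ, 1 < s.re → g s = partialPairL S₀ α β s := by
  classical
  intro n K _ _ μ' _ _ _ νI _ νA _ νK _ ν₀ _ hloc hn P P' hne hor hω S₀ hS₀ α β hα hβ
  -- the central characters of `π` and `σ̄` differ
  obtain ⟨ω, hωu, hωA, hωact, hωS, -, -⟩ := P.exists_centralCharacter_smoothedForm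
  obtain ⟨ω', hω'u, hω'A, hω'act, hω'S, -, -⟩ := P'.conj.exists_centralCharacter_smoothedForm
  have hωne : ω ≠ ω' := by
    intro hωeq
    refine hω fun z => ⟨((ω z : ℂˣ) : ℂ), hωu z, fun f => ?_, fun f' => ?_⟩
    · have h := congrArg Subtype.val (hωact z f)
      rw [ContRepresentation.ClosedSubrep.coe_toContRep_apply, Submodule.coe_smul] at h
      exact h
    · have h := congrArg Subtype.val (hω'act z f')
      rw [ContRepresentation.ClosedSubrep.coe_toContRep_apply, Submodule.coe_smul, ← hωeq] at h
      exact h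
  set χ : Literature.NumberTheory.GaloisRepresentations.HeckeCharacter K := ω * ω'⁻¹ with hχ
  have hχ1 : χ ≠ 1 := by
    intro h
    apply hωne
    have h' := congrArg (· * ω') h
    simpa only [hχ, inv_mul_cancel_right, one_mul] using h'
  have hχ₀ : ∀ t : ℝ≥0ˣ, χ (posRealIdele K t) = 1 := fun t => by
    rw [hχ, Literature.NumberTheory.GaloisRepresentations.HeckeCharacter.mul_apply,
      Literature.NumberTheory.GaloisRepresentations.HeckeCharacter.inv_apply, hωA t, hω'A t, inv_one,
      mul_one]
  -- the local data and the twisted global theorem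
  obtain ⟨m, c, f, f', 𝔫₀, h𝔫₀, η, hη, hηK, S', hS'f, hS₀S', hS', x, y, hx, hy, Φinf, hΦc, hΦ0, hΦS, B, hB,
    hBsum⟩ := hloc hn P P' hne hor hS₀ hα hβ
  obtain ⟨C, hC, hT⟩ :=
    exists_entire_eq_partialPairL_mul_setIntegral_pair_twisted (n := n) (K := K) hn μ' νI νA νK ν₀
  choose F hF hFI hFstrip using fun i : Fin m =>
    hT P P'.conj (f i) (f' i) hωu hω'u hχ hχ1 hχ₀ hα hβ.conj (h𝔫₀ i) (hη i) (hηK i)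
      (fun z g => hωS (η i) (f i) z g) (fun z g => hω'S (η i) (f' i) z g) (hS₀S' i) (hS' i) (hx i) (hy i)
      (hΦc i) (hΦ0 i) (hΦS i)
  -- `∑ c_i F_i = C · L^{S₀} · ∑ c_i A_i` on the strip
  have hββ : (fun v => ((β v).map conj).map conj) = β := funext fun v => multiset_map_conj_map_conj _
  have hmul : ∀ (i : Fin m) (s : ℂ), 1 < s.re → Multipliable fun v : {v : HeightOneSpectrum (𝓞 K) // v ∉ S' i} =>
      ((satakePairPolynomial (α v.1) (β v.1)).eval ((v.1.residueCard : ℂ) ^ (-s)))⁻¹ := fun i s hs =>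
    JacquetShalika1981_multipliable_partialPairL_holds P P' (hα.mono (hS₀S' i)) (hβ.mono (hS₀S' i)) hs
  have hPne : ∀ (i : Fin m) (s : ℂ), 1 < s.re → ∀ v ∈ (hS'f i).toFinset,
      (satakePairPolynomial (α v) (β v)).eval ((v.residueCard : ℂ) ^ (-s)) ≠ 0 := fun i s hs v hv =>
    eval_satakePairPolynomial_ne_zero_of_one_lt_re P P' hα hβ ((hS'f i).mem_toFinset.1 hv).2 hs
  have hsum : ∀ s : ℂ, 1 < s.re → s.re < 2 →
      ∑ i, c i * F i s = ((C : ℂ) * partialPairL S₀ α β s) *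
        ∑ i, c i * ((∏ v ∈ (hS'f i).toFinset,
                (satakePairPolynomial (α v) (β v)).eval ((v.residueCard : ℂ) ^ (-s))) *
              ∫ p in unitBox {v | v ∉ S' i} ×ˢ Set.univ, torusPairIntegrandC n K
                (whittakerCoeff ν₀ (unipotentTateDomain n K) (adeleAddChar K)
                  (invQuot (AdelicGroupData.gl n K) (smoothedForm (η i) ((f i : P.1.toSubmodule) : (AdelicGroupData.gl n K).L2 μ'))))
                (star (whittakerCoeff ν₀ (unipotentTateDomain n K) (adeleAddChar K)
                  (invQuot (AdelicGroupData.gl n K) (smoothedForm (η i) ((f' i : P'.conj.1.toSubmodule) : (AdelicGroupData.gl n K).L2 μ')))))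
                (standardTestFun n K (Φinf i)) s p ∂(νA.prod νK)) := by
    intro s hs1 hs2
    rw [Finset.mul_sum]
    refine Finset.sum_congr rfl fun i _ => ?_
    have h := hFstrip i s hs1 hs2
    beta_reduce at h
    rw [hββ] at h
    have hP0 : (∏ v ∈ (hS'f i).toFinset,
                (satakePairPolynomial (α v) (β v)).eval ((v.residueCard : ℂ) ^ (-s))) ≠ 0 :=
      Finset.prod_ne_zero_iff.2 (hPne i s hs1)
    rw [h, partialPairL_eq_prod_mul_partialPairL (hS₀S' i) (hS'f i) α β (hmul i s hs1), Finset.prod_inv_distrib]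
    field_simp
  -- the entire function `G = C⁻¹ B ∑ c_i F_i`
  set G : ℂ → ℂ := fun s => (C : ℂ)⁻¹ * (B s * ∑ i, c i * F i s) with hGdef
  have hC0 : (C : ℂ) ≠ 0 := Complex.ofReal_ne_zero.2 hC.ne'
  have hsumF : Differentiable ℂ fun s => ∑ i, c i * F i s := by
    have h : Differentiable ℂ (∑ i, fun s => c i * F i s) := Differentiable.sum fun i _ => (hF i).const_mul (c i)
    convert h using 1
    funext s
    simp only [Finset.sum_apply]
  have hG : Differentiable ℂ G := by
    show Differentiable ℂ fun s => (C : ℂ)⁻¹ * (B s * ∑ i, c i * F i s)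
    exact (hB.mul hsumF).const_mul _
  have hGstrip : ∀ s : ℂ, 1 < s.re → s.re < 2 → G s = (fun _ : ℂ => (1 : ℂ)) s * partialPairL S₀ α β s := by
    intro s hs1 hs2
    have h1 := hBsum s hs1 hs2
    show (C : ℂ)⁻¹ * (B s * ∑ i, c i * F i s) = 1 * partialPairL S₀ α β s
    rw [hsum s hs1 hs2, mul_left_comm (B s), h1, mul_one]
    field_simp
  have hGL : ∀ s : ℂ, 1 < s.re → G s = (fun _ : ℂ => (1 : ℂ)) s * partialPairL S₀ α β s :=
    eq_mul_partialPairL_of_eqOn_strip P P' hα hβ hG (differentiable_const _) hGstrip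
  exact ⟨G, hG, fun s hs => by rw [hGL s hs, one_mul]⟩

namespace NotCommonCentral

/-- **The registered stub `stub_htw_isOrtho_of_local` of the line `Sketch` skeleton, verbatim** (name and
signature as registered on stmt-Langlands-13622), discharged by
`partialPairL_entire_of_not_commonCentral_of_local_isOrtho`; kept in the sub-namespace
`NotCommonCentral` so that it does not clash with the skeleton's own declaration of the stub before the
lead replaces its `sorry`. -/
theorem stub_htw_isOrtho_of_local :
    ∀ {n : ℕ} {K : Type} [Field K] [NumberField K]
      {μ' : Measure (AdelicGroupData.gl n K).automorphicQuotient}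
      [(AdelicGroupData.gl n K).IsAutomorphicMeasure μ']
      [MeasurableSpace (AdeleRing (𝓞 K) K)] [BorelSpace (AdeleRing (𝓞 K) K)]
      (νI : Measure (ideleGroup K)) [νI.IsHaarMeasure]
      (νA : Measure (Fin n → ideleGroup K)) [IsHaarMeasure νA]
      (νK : Measure ↥(maximalCompactAdelic n K)) [IsHaarMeasure νK]
      (ν₀ : Measure ↥(adelicUnipotent n K)) [IsHaarMeasure ν₀]
      (_hloc :
        ∀ (_hn : 0 < n)
        (P P' : CuspidalAutomorphicRepGL n K μ') (_hne : P ≠ P'.conj)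
        (_hor : P.1.toSubmodule ⟂ P'.conj.1.toSubmodule)
        {S₀ : Set (HeightOneSpectrum (𝓞 K))} (_hS₀ : S₀.Finite) {α β : SatakeFamily K}
        (_hα : IsSatakeFamilyOf P S₀ α) (_hβ : IsSatakeFamilyOf P' S₀ β),
        ∃ (m : ℕ) (c : Fin m → ℂ) (f : Fin m → P.1.toSubmodule) (f' : Fin m → P'.conj.1.toSubmodule)
        (𝔫₀ : Fin m → Ideal (𝓞 K)) (_h𝔫₀ : ∀ i, 𝔫₀ i ≠ 0)
        (η : Fin m → (AdelicGroupData.gl n K).Adelic → ℝ) (_hη : ∀ i, IsTestFunctionGL n K (η i))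
        (_hηK : ∀ i, ∀ k : (AdelicGroupData.gl n K).Adelic, k ∈ principalCongruenceLevel n K (𝔫₀ i) →
        ∀ g : (AdelicGroupData.gl n K).Adelic, η i (k * g) = η i g)
        (S' : Fin m → Set (HeightOneSpectrum (𝓞 K))) (hS'f : ∀ i, (S' i \ S₀).Finite) (_hS₀S' : ∀ i, S₀ ⊆ S' i)
        (_hS' : ∀ i, ∀ v ∉ S' i, ¬ v.asIdeal ∣ 𝔫₀ i ∧ ¬ v.asIdeal ∣ differentIdeal ℤ (𝓞 K))
        (x y : Fin m → HeightOneSpectrum (𝓞 K) → Fin n → ℂ)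
        (_hx : ∀ i, ∀ v ∉ S' i, (Finset.univ : Finset (Fin n)).val.map (x i v) = α v)
        (_hy : ∀ i, ∀ v ∉ S' i, (Finset.univ : Finset (Fin n)).val.map (y i v) = (β v).map conj)
        (Φinf : Fin m → (Fin n → InfiniteAdeleRing K) → ℝ) (_hΦc : ∀ i, Continuous (Φinf i))
        (_hΦ0 : ∀ i, ∀ z, 0 ≤ Φinf i z)
        (_hΦS : ∀ i, (fun v => ((standardTestFun n K (Φinf i) v : ℝ) : ℂ)) ∈ piSchwartzBruhat K (Fin n))
        (B : ℂ → ℂ), Differentiable ℂ B ∧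
        ∀ s : ℂ, 1 < s.re → s.re < 2 →
        B s * (∑ i, c i * ((∏ v ∈ (hS'f i).toFinset,
        (satakePairPolynomial (α v) (β v)).eval ((v.residueCard : ℂ) ^ (-s))) *
        ∫ p in unitBox {v | v ∉ S' i} ×ˢ Set.univ, torusPairIntegrandC n K
        (whittakerCoeff ν₀ (unipotentTateDomain n K) (adeleAddChar K)
        (invQuot (AdelicGroupData.gl n K) (smoothedForm (η i) ((f i : P.1.toSubmodule) : (AdelicGroupData.gl n K).L2 μ'))))
        (star (whittakerCoeff ν₀ (unipotentTateDomain n K) (adeleAddChar K)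
        (invQuot (AdelicGroupData.gl n K) (smoothedForm (η i) ((f' i : P'.conj.1.toSubmodule) : (AdelicGroupData.gl n K).L2 μ')))))
        (standardTestFun n K (Φinf i)) s p ∂(νA.prod νK))) = 1),
      ∀ (_hn : 0 < n)
      (P P' : CuspidalAutomorphicRepGL n K μ') (_hne : P ≠ P'.conj)
      (_hor : P.1.toSubmodule ⟂ P'.conj.1.toSubmodule)
      (_hω : ¬ (∀ z : ideleGroup K, ∃ c : ℂ, ‖c‖ = 1 ∧
      (∀ f : P.1.toSubmodule,
      (AdelicGroupData.gl n K).rightRegular μ' (Matrix.GeneralLinearGroup.scalar (Fin n) z)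
      (f : (AdelicGroupData.gl n K).L2 μ') = c • (f : (AdelicGroupData.gl n K).L2 μ')) ∧
      (∀ f' : P'.conj.1.toSubmodule,
      (AdelicGroupData.gl n K).rightRegular μ' (Matrix.GeneralLinearGroup.scalar (Fin n) z)
      (f' : (AdelicGroupData.gl n K).L2 μ') = c • (f' : (AdelicGroupData.gl n K).L2 μ'))))
      {S₀ : Set (HeightOneSpectrum (𝓞 K))} (_hS₀ : S₀.Finite) {α β : SatakeFamily K}
      (_hα : IsSatakeFamilyOf P S₀ α) (_hβ : IsSatakeFamilyOf P' S₀ β),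
      ∃ g : ℂ → ℂ, Differentiable ℂ g ∧ ∀ s : ℂ, 1 < s.re → g s = partialPairL S₀ α β s := by
  exact @partialPairL_entire_of_not_commonCentral_of_local_isOrtho

end NotCommonCentral

end Summit.Langlands.Langlands.Theorems

end
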